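import Summits.BirchSwinnertonDyer.BirchSwinnertonDyer.Theorems.AdditiveKolyvaginRoadManinFrameResidueProperRTameTwistFullEuler
import Summits.BirchSwinnertonDyer.BirchSwinnertonDyer.Theorems.AdditiveKolyvaginRoadManinFrameResidueProperRTameTwistCharacter
import Mathlib.NumberTheory.LegendreSymbol.QuadraticReciprocity

/-!
# Route `ManinLocalTwoThree`, crux C3 `ManinPrimeToThreeAtNine` (stmt-BirchSwinnertonDyer-22968), line
# `kato-shift-three` (es g6), stub `stub_three_dvd_shiftClass`: ADMISSIBLE auxiliary primes `ℓ ≡ 11 (mod 12)`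
# — the odd characters mod `ℓ` satisfy the binders of the `p = 3` Kato fact, and the symmetrised Euler
# factors at the primes `q ∥ N` are `3`-units under the Legendre conditions (line prover p1; helper)

Pure arithmetic of Dirichlet characters modulo a prime `ℓ ≡ 11 (mod 12)` (no modular form). For every
character `χ (mod ℓ)`:
* `not_three_dvd_orderOf` — `3 ∤ ord χ` (`ord χ ∣ φ(ℓ) = ℓ − 1 ≡ 10 (mod 12)`);
* `isSquare_three` — `3` is a square mod `ℓ` (quadratic reciprocity: `(3/ℓ) = −(ℓ/3) = −(2/3) = 1`);
* `apply_three_pow_div_two`, `apply_three_ne_neg_one` — `χ(3)^{(ℓ−1)/2} = 1` (Euler's criterion), and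
  `(ℓ−1)/2` is odd, so `χ(3) ≠ −1`;
* `ne_one_of_odd`, `isPrimitive_of_odd` — an ODD `χ` is `≠ 1` and primitive;
so that for an odd `χ` with `χ(3) ≠ 1` the binders `χ` primitive, `χ ≠ 1`, `3 ∤ ord χ`, `χ(3) ∉ {1, −1}` of
the tree fact `kato_neron_isIntegral_twistedSymbolSum_of_additive_three_polar` hold.

Euler units (`…RTameTwistFullEuler` of bsd-wall at `p = 3`): for a prime `q ∉ {3, ℓ}`, `a ∈ {1, −1}`
(the `a_q` of a multiplicative prime `q ∥ N`) and an ODD `χ`: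
* `apply_ne_one_of_odd_of_not_isSquare` — if `q` is a non-residue mod `ℓ` then `χ(q) ≠ 1`
  (`q^{(ℓ−1)/2} = −1` and `χ(−1) = −1`);
* `exists_symmEulerFactor_mul_eq_three` — under the LEGENDRE CONDITION of the line's `AdmissiblePrime`
  («`q·a ≡ 1 (mod 3)` ⟹ `q` non-residue mod `ℓ`; `q·a ≢ 1 (mod 3)` ⟹ `q` residue mod `ℓ`»):
  `(q − aχ(q))(q − aχ(q)⁻¹)·w = t` with `w` integral, `t ∈ ℤ`, `3 ∤ t`;
* `exists_symmEuler_prod_mul_eq_three` — the product over the `q ∥ N` (the fact's symmetrised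
  `N`-imprimitivity factor `∏_{q ∥ N}(q − a_qχ(q))(q − a_qχ(q)⁻¹)`) is a `3`-unit in the same sense.

Nothing about BSD or about Manin's conjecture is proved here.
-/

set_option autoImplicit false
set_option linter.dupNamespace false

noncomputable section

open scoped Classical

open Summit.BirchSwinnertonDyer.BirchSwinnertonDyer.Theorems.ManinFrameResidueProperRTameTwist

namespace Summit.BirchSwinnertonDyer.BirchSwinnertonDyer.Theorems.ManinLocalTwoThree

section Admissible

variable {ℓ : ℕ} [hℓ : Fact ℓ.Prime]

omit hℓ in
/-- `ℓ ≡ 11 (mod 12)` unpacked: `ℓ % 4 = 3`, `ℓ % 3 = 2`, `3 ∤ ℓ − 1`, `ℓ ≠ 2`, `ℓ ≠ 3`, `(ℓ − 1)/2`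
odd. [folklore] -/
theorem mod_twelve_facts (h12 : ℓ % 12 = 11) :
    ℓ % 4 = 3 ∧ ℓ % 3 = 2 ∧ ¬ 3 ∣ ℓ - 1 ∧ ℓ ≠ 2 ∧ ℓ ≠ 3 ∧ ¬ 2 ∣ ℓ / 2 := by
  omega

/-- **`3 ∤ ord χ`** for every Dirichlet character mod a prime `ℓ ≡ 11 (mod 12)`. [folklore] -/
theorem not_three_dvd_orderOf (h12 : ℓ % 12 = 11) (χ : DirichletCharacter ℂ ℓ) :
    ¬ 3 ∣ orderOf χ := by
  intro h
  have h1 : orderOf χ ∣ Fintype.card (DirichletCharacter ℂ ℓ) := orderOf_dvd_card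
  have h2 : Fintype.card (DirichletCharacter ℂ ℓ) = ℓ.totient := by
    rw [← Nat.card_eq_fintype_card]
    exact DirichletCharacter.card_eq_totient_of_hasEnoughRootsOfUnity ℂ ℓ
  rw [h2, Nat.totient_prime hℓ.out] at h1
  exact (mod_twelve_facts h12).2.2.1 (h.trans h1)

/-- **`3` is a square modulo a prime `ℓ ≡ 11 (mod 12)`**: `(3/ℓ) = −(ℓ/3) = −(2/3) = 1`
(quadratic reciprocity for two primes `≡ 3 (mod 4)`). [folklore] -/
theorem isSquare_three (h12 : ℓ % 12 = 11) : IsSquare ((3 : ℕ) : ZMod ℓ) := by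
  obtain ⟨h4, h3, -, -, hℓ3, -⟩ := mod_twelve_facts h12
  haveI : Fact (Nat.Prime 3) := ⟨Nat.prime_three⟩
  have h30 : ((3 : ℕ) : ZMod ℓ) ≠ 0 := by
    rw [Ne, ZMod.natCast_eq_zero_iff]
    intro h
    exact hℓ3 ((Nat.prime_dvd_prime_iff_eq hℓ.out Nat.prime_three).mp h)
  rw [← legendreSym.eq_one_iff' ℓ h30]
  have hrec : legendreSym ℓ 3 = -legendreSym 3 ℓ :=
    legendreSym.quadratic_reciprocity_three_mod_four (by norm_num) h4
  have h2 : legendreSym 3 ℓ = -1 := by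
    rw [legendreSym.mod 3 (ℓ : ℤ)]
    have : ((ℓ : ℤ) % ((3 : ℕ) : ℤ)) = 2 := by omega
    rw [this, legendreSym.eq_neg_one_iff]
    have := (ZMod.exists_sq_eq_two_iff (p := 3) (by norm_num)).not
    push_cast
    exact this.mpr (by norm_num)
  rw [show ((3 : ℕ) : ℤ) = 3 by norm_num, hrec, h2, neg_neg]

/-- **`χ(3)^{(ℓ−1)/2} = 1`** (Euler's criterion for the square `3`). [folklore] -/
theorem apply_three_pow_div_two (h12 : ℓ % 12 = 11) (χ : DirichletCharacter ℂ ℓ) :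
    χ (3 : ZMod ℓ) ^ (ℓ / 2) = 1 := by
  obtain ⟨-, -, -, -, hℓ3, -⟩ := mod_twelve_facts h12
  have h30 : ((3 : ℕ) : ZMod ℓ) ≠ 0 := by
    rw [Ne, ZMod.natCast_eq_zero_iff]
    intro h
    exact hℓ3 ((Nat.prime_dvd_prime_iff_eq hℓ.out Nat.prime_three).mp h)
  have h := (ZMod.euler_criterion ℓ h30).mp (isSquare_three h12)
  rw [← map_pow, show (3 : ZMod ℓ) = ((3 : ℕ) : ZMod ℓ) by norm_num, h, map_one]

/-- **`χ(3) ≠ −1`** for a prime `ℓ ≡ 11 (mod 12)` (`(ℓ−1)/2` is odd). [folklore] -/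
theorem apply_three_ne_neg_one (h12 : ℓ % 12 = 11) (χ : DirichletCharacter ℂ ℓ) :
    χ (3 : ZMod ℓ) ≠ -1 := by
  intro h
  have hodd : Odd (ℓ / 2) := Nat.odd_iff.mpr (by have := (mod_twelve_facts h12).2.2.2.2.2; omega)
  have := apply_three_pow_div_two h12 χ
  rw [h, hodd.neg_one_pow] at this
  norm_num at this

omit hℓ in
/-- An odd character is not the trivial character. [folklore] -/
theorem ne_one_of_odd [NeZero ℓ] {χ : DirichletCharacter ℂ ℓ} (hχ : χ.Odd) : χ ≠ 1 := by
  intro h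
  have h1 : χ (-1) = -1 := hχ
  rw [h, MulChar.one_apply (isUnit_one.neg)] at h1
  norm_num at h1

/-- An odd character modulo a prime is primitive. [folklore] -/
theorem isPrimitive_of_odd {χ : DirichletCharacter ℂ ℓ} (hχ : χ.Odd) : χ.IsPrimitive := by
  rw [DirichletCharacter.isPrimitive_def]
  rcases (Nat.dvd_prime hℓ.out).mp (DirichletCharacter.conductor_dvd_level χ) with h | h
  · exact absurd (DirichletCharacter.eq_one_iff_conductor_eq_one.mpr h) (ne_one_of_odd hχ)
  · exact h

/-! ### Euler units at the multiplicative primes -/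

/-- **Non-residues are detected by odd characters**: if `q` is a non-square unit mod `ℓ`, then
`χ(q) ≠ 1` for every ODD `χ` (`q^{(ℓ−1)/2} = −1`, so `χ(q) = 1` would give `χ(−1) = 1`). [folklore] -/
theorem apply_ne_one_of_odd_of_not_isSquare {q : ZMod ℓ} (hq0 : q ≠ 0) (hq : ¬ IsSquare q)
    {χ : DirichletCharacter ℂ ℓ} (hχ : χ.Odd) : χ q ≠ 1 := by
  intro h1
  have hpow : q ^ (ℓ / 2) = -1 :=
    (ZMod.pow_div_two_eq_neg_one_or_one ℓ hq0).resolve_left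
      (fun h ↦ hq ((ZMod.euler_criterion ℓ hq0).mpr h))
  have : χ (-1) = 1 := by rw [← hpow, map_pow, h1, one_pow]
  have h2 : χ (-1) = -1 := hχ
  rw [this] at h2
  norm_num at h2

/-- Squares are killed by the `(ℓ−1)/2`-th power: `χ(q)^{(ℓ−1)/2} = 1` for a square unit `q`.
[folklore] -/
theorem apply_pow_div_two_eq_one_of_isSquare {q : ZMod ℓ} (hq0 : q ≠ 0) (hq : IsSquare q)
    (χ : DirichletCharacter ℂ ℓ) : χ q ^ (ℓ / 2) = 1 := by
  rw [← map_pow, (ZMod.euler_criterion ℓ hq0).mp hq, map_one]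

/-- **The symmetrised Euler factor at a multiplicative prime is a `3`-unit under the Legendre
condition.** `ℓ ≡ 11 (mod 12)` prime, `q ∉ {3, ℓ}` prime, `a ∈ {1, −1}`, `χ` an ODD character mod `ℓ`, and:
if `q·a ≡ 1 (mod 3)` then `q` is a NON-residue mod `ℓ` (so `χ(q) ≠ 1`: resonant case,
`exists_symmEulerFactor_mul_eq_of_modEq`), else `q` is a residue mod `ℓ` (so `χ(q)` has odd order
`∣ (ℓ−1)/2`: `exists_symmEulerFactor_mul_eq_of_oddOrder`). Then `(q − aχ(q))(q − aχ(q)⁻¹)·w = t`,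
`w` integral, `t ∈ ℤ`, `3 ∤ t`. [folklore] -/
theorem exists_symmEulerFactor_mul_eq_three (h12 : ℓ % 12 = 11) {q : ℕ} (hq : q.Prime)
    (hq3 : q ≠ 3) (hqℓ : q ≠ ℓ) {a : ℤ} (ha : a = 1 ∨ a = -1) {χ : DirichletCharacter ℂ ℓ}
    (hχ : χ.Odd)
    (hL : ((3 : ℤ) ∣ (q : ℤ) * a - 1 → ¬ IsSquare ((q : ℕ) : ZMod ℓ)) ∧
      (¬ (3 : ℤ) ∣ (q : ℤ) * a - 1 → IsSquare ((q : ℕ) : ZMod ℓ))) :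
    ∃ (w : ℂ) (t : ℤ), IsIntegral ℤ w ∧
      (((q : ℂ) - (a : ℂ) * χ (q : ZMod ℓ)) * ((q : ℂ) - (a : ℂ) * (χ (q : ZMod ℓ))⁻¹)) * w = t ∧
        ¬ ((3 : ℕ) : ℤ) ∣ t := by
  haveI : Fact (Nat.Prime 3) := ⟨Nat.prime_three⟩
  obtain ⟨-, -, h3ℓ1, -, -, hodd⟩ := mod_twelve_facts h12
  have hq0 : ((q : ℕ) : ZMod ℓ) ≠ 0 := by
    rw [Ne, ZMod.natCast_eq_zero_iff]
    intro h
    exact hqℓ ((Nat.prime_dvd_prime_iff_eq hℓ.out hq).mp h).symm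
  have ha3 : ¬ (3 : ℤ) ∣ a := by rcases ha with rfl | rfl <;> decide
  have ha2 : a * a = 1 := by rcases ha with rfl | rfl <;> norm_num
  by_cases hres : (3 : ℤ) ∣ (q : ℤ) * a - 1
  · -- resonant: `q ≡ a (mod 3)`, `χ(q) ≠ 1`
    have hqa : (3 : ℤ) ∣ (q : ℤ) - a := by
      have : (q : ℤ) - a = a * ((q : ℤ) * a - 1) := by linear_combination -(q : ℤ) * ha2
      rw [this]; exact hres.mul_left a
    have hne : (q : ℤ) ≠ a := by
      rcases ha with rfl | rfl
      · exact_mod_cast hq.one_lt.ne'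
      · have := hq.pos; omega
    have hζ1 : χ (q : ZMod ℓ) ≠ 1 := apply_ne_one_of_odd_of_not_isSquare hq0 (hL.1 hres) hχ
    have hζn : χ (q : ZMod ℓ) ^ (ℓ - 1) = 1 := by
      rw [← map_pow, ZMod.pow_card_sub_one_eq_one hq0, map_one]
    have hn : 0 < ℓ - 1 := Nat.sub_pos_of_lt hℓ.out.one_lt
    have hpn : ¬ ((3 : ℕ) : ℤ) ∣ ((ℓ - 1 : ℕ) : ℤ) := by exact_mod_cast h3ℓ1
    exact exists_symmEulerFactor_mul_eq_of_modEq (p := 3) q a (by exact_mod_cast hqa)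
      (by exact_mod_cast ha3) hne hn hpn hζn hζ1
  · -- anti-resonant: `q/a ≢ 1 (mod 3)`, `χ(q)` of odd order dividing `(ℓ−1)/2`
    have hq30 : ((q : ℕ) : ZMod 3) ≠ 0 := by
      rw [Ne, ZMod.natCast_eq_zero_iff]
      intro h
      exact hq3 ((Nat.prime_dvd_prime_iff_eq Nat.prime_three hq).mp h).symm
    have hA : (q : ZMod 3) / (a : ZMod 3) ≠ 1 := by
      intro h
      apply hres
      have hainv : (a : ZMod 3)⁻¹ = (a : ZMod 3) := by
        have haa : (a : ZMod 3) * (a : ZMod 3) = 1 := by exact_mod_cast congrArg (Int.cast : ℤ → ZMod 3) ha2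
        exact inv_eq_of_mul_eq_one_right haa
      rw [div_eq_mul_inv, hainv] at h
      have : (((q : ℤ) * a - 1 : ℤ) : ZMod 3) = 0 := by push_cast; rw [h, sub_self]
      exact (ZMod.intCast_zmod_eq_zero_iff_dvd _ 3).mp this
    have hζ : χ (q : ZMod ℓ) ^ (ℓ / 2) = 1 :=
      apply_pow_div_two_eq_one_of_isSquare hq0 (hL.2 hres) χ
    have hn : 0 < ℓ / 2 := Nat.div_pos hℓ.out.two_le two_pos
    exact exists_symmEulerFactor_mul_eq_of_oddOrder (p := 3) q a hq30 hA hn hodd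
      (fun r hr hr2 hr3 _ ↦ hr2 ((Nat.prime_dvd_prime_iff_eq hr Nat.prime_two).mp
        (by simpa using hr3))) hζ

/-- **The symmetrised `N`-imprimitivity factor is a `3`-unit** for an odd character modulo an
admissible `ℓ`: product over the primes `q ∥ N` (`q ∣ N`, `q² ∤ N`), each with `a_q ∈ {1, −1}`, `q ≠ ℓ`,
`q ≠ 3`, and the Legendre condition. [folklore] -/
theorem exists_symmEuler_prod_mul_eq_three (h12 : ℓ % 12 = 11) {N : ℕ} (a : ℕ → ℤ)
    (ha : ∀ q ∈ N.primeFactors, ¬ q ^ 2 ∣ N → a q = 1 ∨ a q = -1)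
    (h3 : ∀ q ∈ N.primeFactors, ¬ q ^ 2 ∣ N → q ≠ 3)
    (hℓN : ¬ ℓ ∣ N) {χ : DirichletCharacter ℂ ℓ} (hχ : χ.Odd)
    (hL : ∀ q ∈ N.primeFactors, ¬ q ^ 2 ∣ N →
      ((3 : ℤ) ∣ (q : ℤ) * a q - 1 → ¬ IsSquare ((q : ℕ) : ZMod ℓ)) ∧
        (¬ (3 : ℤ) ∣ (q : ℤ) * a q - 1 → IsSquare ((q : ℕ) : ZMod ℓ))) :
    ∃ (w : ℂ) (t : ℤ), IsIntegral ℤ w ∧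
      (∏ q ∈ N.primeFactors with ¬ q ^ 2 ∣ N,
          (((q : ℂ) - (a q : ℂ) * χ (q : ZMod ℓ)) * ((q : ℂ) - (a q : ℂ) * (χ (q : ZMod ℓ))⁻¹))) *
        w = t ∧ ¬ ((3 : ℕ) : ℤ) ∣ t := by
  refine exists_prod_mul_eq Nat.prime_three _ _ fun q hq ↦ ?_
  obtain ⟨hqN, hq2⟩ := Finset.mem_filter.mp hq
  have hqp : q.Prime := Nat.prime_of_mem_primeFactors hqN
  have hqℓ : q ≠ ℓ := by
    rintro rfl
    exact hℓN (Nat.dvd_of_mem_primeFactors hqN)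
  exact exists_symmEulerFactor_mul_eq_three h12 hqp (h3 q hqN hq2) hqℓ (ha q hqN hq2) hχ (hL q hqN hq2)

end Admissible

end Summit.BirchSwinnertonDyer.BirchSwinnertonDyer.Theorems.ManinLocalTwoThree

end
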